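import Summits.RiemannHypothesis.RiemannHypothesis.Theorems.HandoffLatticeUncertainty
import Mathlib.Analysis.Fourier.PoissonSummation
import HarnessLib

/-!
# L-DUAL — the dilation sum below the window is a lattice sum of the Fourier transform (Poisson)

Handoff track (ROUTE 1′), prove-1 gen14, ATTEMPT-21 §5.2′ / idea-1 PART XXIII §131.3 (request
L-DUAL over this track's definitions). For a Schwartz function `f` on `ℝ` that is even, with
`f(0) = 0` and `𝓕 f(0) = ∫ f = 0` (Connes–Consani's two 𝒮₀ conditions) and `f = 0` beyond `λ`, the
dilation sum `θ_f(u) = Σ_{1 ≤ n ≤ ⌊λ/u⌋} f(nu)` (`dilationSum λ f u`, part 1 of THEOREM U0) is, for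
every `u > 0`,
`θ_f(u) = u⁻¹ Σ_{k ≥ 1} 𝓕 f(k/u)` (`dilationSum_eq_tsum_fourier`).
This is Poisson summation (Mathlib `SchwartzMap.tsum_eq_tsum_fourier`) for the dilate
`x ↦ f(xu)` (a Schwartz function; `𝓕(f(·u))(ξ) = u⁻¹ 𝓕 f(ξ/u)`, `fourier_comp_mul_right`), with the
two `𝒮₀` conditions removing the `n = 0` and `k = 0` terms and evenness folding `ℤ` onto `ℕ⁺`
(Mathlib `tsum_int_eq_zero_add_two_mul_tsum_pnat`). Consequence (IDEAS-prolate §127.0, «(D-mass)»):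
below the window, `T_λ(f) = ∫_0^{1/λ}|θ_f|² = ∫_λ^∞ |Σ_{k≥1} 𝓕f(kv)|² dv` involves only the
out-of-band spectrum. Nothing here bears on the truth of RH.
-/

set_option linter.dupNamespace false

noncomputable section

open Complex MeasureTheory Set Filter Finset SchwartzMap
open scoped Real FourierTransform

namespace Summit.RiemannHypothesis.RiemannHypothesis.Theorems

namespace LatticeUncertainty

/-- Fourier transform of a dilate: `𝓕(x ↦ f(xu))(ξ) = u⁻¹ • 𝓕 f(ξ/u)` for `u > 0`. -/
theorem fourier_comp_mul_right (f : ℝ → ℂ) {u : ℝ} (hu : 0 < u) (ξ : ℝ) :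
    𝓕 (fun x ↦ f (x * u)) ξ = (u⁻¹ : ℝ) • 𝓕 f (ξ / u) := by
  rw [Real.fourier_real_eq, Real.fourier_real_eq]
  have h : (fun v : ℝ ↦ 𝐞 (-(v * ξ)) • f (v * u))
      = fun v ↦ (fun y : ℝ ↦ 𝐞 (-(y * (ξ / u))) • f y) (v * u) := by
    funext v
    change 𝐞 (-(v * ξ)) • f (v * u) = 𝐞 (-(v * u * (ξ / u))) • f (v * u)
    rw [show v * u * (ξ / u) = v * ξ by field_simp]
  rw [h, Measure.integral_comp_mul_right (fun y : ℝ ↦ 𝐞 (-(y * (ξ / u))) • f y) u,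
    abs_of_pos (inv_pos.2 hu)]

/-- The dilate `x ↦ f(xu)` of a Schwartz function, as a Schwartz function (`u ≠ 0`). -/
def dilate (f : 𝓢(ℝ, ℂ)) {u : ℝ} (hu : u ≠ 0) : 𝓢(ℝ, ℂ) :=
  SchwartzMap.compCLMOfContinuousLinearEquiv ℂ
    (ContinuousLinearEquiv.unitsEquivAut ℝ (Units.mk0 u hu)) f

/-- `dilate f hu x = f (x u)`. -/
@[simp] theorem dilate_apply (f : 𝓢(ℝ, ℂ)) {u : ℝ} (hu : u ≠ 0) (x : ℝ) :
    dilate f hu x = f (x * u) := rfl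

/-- A Schwartz function restricted to `ℤ` is summable. -/
theorem summable_int_schwartz (g : 𝓢(ℝ, ℂ)) : Summable fun n : ℤ ↦ g n :=
  summable_of_isBigO (Real.summable_abs_int_rpow one_lt_two)
    ((g.isBigO_cocompact_rpow (-2)).comp_tendsto Int.tendsto_coe_cofinite)

/-- For `f` vanishing beyond `λ` and `u > 0`: `Σ_{n ≥ 1} f(nu)` over `ℕ⁺` is the finite dilation sum. -/
theorem tsum_pnat_eq_dilationSum (f : ℝ → ℂ) {lam u : ℝ} (hu : 0 < u)
    (hsupp : ∀ x, lam < x → f x = 0) :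
    ∑' n : ℕ+, f (n * u) = dilationSum lam f u := by
  unfold dilationSum
  -- the `ℕ⁺`-indexed family has support in `{n : n ≤ ⌊λ/u⌋}`
  have hzero : ∀ n : ℕ+, ⌊lam / u⌋₊ < (n : ℕ) → f (n * u) = 0 := by
    intro n hn
    apply hsupp
    have : lam / u < (n : ℕ) := Nat.lt_of_floor_lt hn
    rw [div_lt_iff₀ hu] at this
    exact_mod_cast this
  set N := ⌊lam / u⌋₊ with hN
  -- compare both with the sum over `Finset.range N` of `f ((k+1) u)`
  have h1 : ∑' n : ℕ+, f (n * u) = ∑ k ∈ Finset.range N, f ((k + 1 : ℕ) * u) := by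
    rw [← Equiv.pnatEquivNat.symm.tsum_eq]
    simp only [Equiv.pnatEquivNat_symm_apply, Nat.succPNat_coe, Nat.cast_succ]
    refine tsum_eq_sum fun k hk ↦ ?_
    rw [Finset.mem_range, not_lt] at hk
    have := hzero (Nat.succPNat k) (by simp [Nat.succPNat]; omega)
    simpa [Nat.succPNat, Nat.cast_succ] using this
  have h2 : ∑ n ∈ Finset.Icc 1 N, f (n * u) = ∑ k ∈ Finset.range N, f ((k + 1 : ℕ) * u) := by
    rw [← Finset.Ico_succ_right_eq_Icc, Finset.sum_Ico_eq_sum_range]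
    refine Finset.sum_congr (by simp) fun k _ ↦ ?_
    rw [add_comm]
  rw [h1, h2]

/-- ★ **L-DUAL (pointwise Poisson form).** For an even Schwartz function `f` with `f(0) = 0`,
`𝓕 f(0) = 0` and `f = 0` beyond `λ`, and every `u > 0`:
`dilationSum λ f u = u⁻¹ · Σ_{k ≥ 1} 𝓕 f(k/u)`. [cite: ConnesConsani2023, §1 p. 3 and §3 (3.1)
(the map ℰ); IDEAS-prolate §127.0 (D-mass)] -/
theorem dilationSum_eq_tsum_fourier (f : 𝓢(ℝ, ℂ)) {lam : ℝ} (heven : ∀ x, f (-x) = f x)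
    (h0 : f 0 = 0) (hmass : 𝓕 (f : ℝ → ℂ) 0 = 0) (hsupp : ∀ x, lam < x → f x = 0)
    {u : ℝ} (hu : 0 < u) :
    dilationSum lam f u = (u : ℂ)⁻¹ * ∑' k : ℕ+, 𝓕 (f : ℝ → ℂ) ((k : ℕ) / u) := by
  set g : 𝓢(ℝ, ℂ) := dilate f hu.ne' with hg
  -- Poisson at `x = 0`
  have hP := g.tsum_eq_tsum_fourier 0
  simp only [zero_add, QuotientAddGroup.mk_zero, fourier_eval_zero, mul_one] at hP
  -- both sides are even and summable; fold onto `ℕ⁺`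
  have hg_even : (fun n : ℤ ↦ g n).Even := fun n ↦ by
    simp only [hg, dilate_apply, Int.cast_neg, neg_mul, heven]
  have hFg : ∀ ξ : ℝ, 𝓕 (g : ℝ → ℂ) ξ = (u⁻¹ : ℝ) • 𝓕 (f : ℝ → ℂ) (ξ / u) := fun ξ ↦ by
    have : (g : ℝ → ℂ) = fun x ↦ f (x * u) := funext fun x ↦ rfl
    rw [this, fourier_comp_mul_right _ hu]
  have hFf_even : ∀ ξ : ℝ, 𝓕 (f : ℝ → ℂ) (-ξ) = 𝓕 (f : ℝ → ℂ) ξ := fun ξ ↦ by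
    rw [Real.fourier_real_eq, Real.fourier_real_eq, ← integral_neg_eq_self]
    refine integral_congr_ae (Eventually.of_forall fun v ↦ ?_)
    simp only [neg_mul, mul_neg, neg_neg, heven]
  have hFg_even : (fun n : ℤ ↦ 𝓕 g n).Even := fun n ↦ by
    change 𝓕 (g : ℝ → ℂ) ((-n : ℤ) : ℝ) = 𝓕 (g : ℝ → ℂ) (n : ℝ)
    rw [hFg, hFg, Int.cast_neg, neg_div, hFf_even]
  have hsum_g : Summable fun n : ℤ ↦ g n := summable_int_schwartz g
  have hsum_Fg : Summable fun n : ℤ ↦ 𝓕 g n := summable_int_schwartz (𝓕 g)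
  rw [tsum_int_eq_zero_add_two_mul_tsum_pnat hg_even hsum_g,
    tsum_int_eq_zero_add_two_mul_tsum_pnat hFg_even hsum_Fg] at hP
  -- the two `𝒮₀` conditions remove the central terms
  have hg0 : g (0 : ℤ) = 0 := by simp [hg, h0]
  have hFg0 : 𝓕 g (0 : ℤ) = 0 := by
    change 𝓕 (g : ℝ → ℂ) ((0 : ℤ) : ℝ) = 0
    rw [hFg, Int.cast_zero, zero_div, hmass, smul_zero]
  rw [hg0, hFg0, zero_add, zero_add, two_nsmul, two_nsmul, ← two_mul, ← two_mul] at hP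
  have hP' : ∑' n : ℕ+, g (n : ℤ) = ∑' n : ℕ+, 𝓕 g (n : ℤ) :=
    mul_left_cancel₀ two_ne_zero hP
  -- identify the two sides
  have hL : ∑' n : ℕ+, g (n : ℤ) = dilationSum lam f u := by
    rw [← tsum_pnat_eq_dilationSum f hu hsupp]
    exact tsum_congr fun n ↦ by simp [hg]
  have hR : ∑' n : ℕ+, 𝓕 g (n : ℤ) = (u : ℂ)⁻¹ * ∑' k : ℕ+, 𝓕 (f : ℝ → ℂ) ((k : ℕ) / u) := by
    rw [← tsum_mul_left]
    refine tsum_congr fun n ↦ ?_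
    change 𝓕 (g : ℝ → ℂ) ((n : ℤ) : ℝ) = _
    rw [hFg, Complex.real_smul]
    push_cast
    rfl
  rw [← hL, hP', hR]

end LatticeUncertainty

end Summit.RiemannHypothesis.RiemannHypothesis.Theorems
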